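/-
Copyright: the b2b-balaban cell (near-miss cell 7), T⁴-continuum CRUX team (coordinator ruling e34b3e0c item (2)),
seat t4-ne7b-formalise-leaf-06 (gen 28). Released under the licence of the surrounding project.
-/
import Summits.QuantumFields.BalabanUV.T4Continuum.Spine.NE7b.EnergyQuantumLemma
import Summits.QuantumFields.BalabanUV.T4Continuum.Spine.NE7b.CovariantMeanValueInequality

/-!
# The energy dichotomy (L1) for critical unit-quaternion Wilson configurations on `ℤ⁴`
# (route NE7b R-H, `t4/ROUTES-NE7b.md` v6.1 Δv6 item 3: DICHOTOMY (L1) = (β₄) + (μ))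

Cell `pub-balaban`, sub-cell `t4`, spine estimate NE7b (node U5c), candidate route R-H ∕ C-RH°. ROUTES-NE7b v6 item 3:

  (L1) «a configuration critical on every link of a hole `I` (the all-free plaquettes) whose COLLAR (plaquettes adjacent
  to `I`) is `≤ b` satisfies EITHER `sup_I s ≤ (1+η)·b` OR `½Σ_I s² ≥ ε₁(η)`», `s(x) := max_{μν} ‖E_{μν}(x)‖`;
  «on the first branch nothing more is needed — the branch IS the sup bound» (PRICING-NE7b v6 F28: under bill B
  «(E)+(L1) close for EVERY minimiser — no uniqueness, no PH-k″, no (G), no (Q*), no ℓ-clause»).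

THIS FILE PROVES (L1) in the kernel for `d = 4`, as the composition of two landed pieces BY NAME:
* `CovariantMeanValueInequality.meanValue_inequality` ((β₄), p254430): `8‖E_{ij}(x)‖ ≤ Σ_{λ,±}‖E_{ij}(x±e_λ)‖ + 464·m²`
  at a plaquette whose four links are critical, `m` an envelope for the faces of the cubes through it (`m ≤ ½`);
* `EnergyQuantumLemma.energy_quantum` ((μ) = (T-k5), this lineage): the law-free energy quantum for lattice subsolutions
  with a quadratic source, modulo the named heat-kernel hypothesis `hC : n²·P_n(x,y) ≤ C` on `ℤ⁴`.
Objects: `siteCurv U x := max_{(i,j)} ‖E_{ij}(x)‖` (§1; the orientation-maximum of subsolutions with a common source is a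
subsolution, `siteCurv_subsolution`). RESULT **`dichotomy`** (§2): `U` a unit-quaternion configuration on `ℤ⁴`, `I`
finite; every link of every plaquette based in `I` critical (`covDiv = 0`); `Re P ≥ 0` everywhere; `‖E‖ ≤ ½` on `I`;
`‖E‖ ≤ b` at every base point outside `I` (the collar AND beyond — harmless in Bałaban's setting, where the whole
exterior is sub-threshold); `η > 0`. Then EITHER `‖E_{ij}(x)‖ ≤ (1+η)·b` for all `x ∈ I`, all `i, j`, OR
`Σ_{x∈I} siteCurv(x)² ≥ η⁴∕((1+η)⁴·C·464²)`; **`dichotomy_sum`**: the same with the energy `Σ_{x∈I} Σ_{(i,j)} ‖E_{ij}(x)‖²`.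

HONEST FRAMING. Law-free kernel facts about ONE configuration, conditional on the named heat-kernel bound `hC` (Lawler 1991
Thm 1.2.1's uniform corollary; not proved in the tree) exactly as `energy_quantum` is; the constant `464 = C′_4` is the
kernel's crude one (ROUTES: `∈ [8, 464]`); nothing of (JC) (the certified collar), of (S-E)'s small competitor, of
(MP<L²)'s clauses, nothing of [Bałaban 1983–89] asserted or cited; the `SU(2) ↔` unit-quaternion bridge NOT formalised.
NE7b (`T4WeightBudget.RelWeightBound`) NOT PRINTED and NOT PROVED; spine PROVED 0∕9; rung (B)+1 on a FINITE torus T⁴ —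
NOT infinite volume, NOT the mass gap, NOT Clay. HONEST DEPENDENCY: continuum YM on T⁴ ⇐ BetaPertH ∧ nine spine estimates
(0/9 proved); BetaPertH ⇐ (D1) ∧ (D4) ∧ CAP+tail; G-an2-4 gates asym, D1 and NE2/3/4. POLICY: crux-route work under
`Spine/NE7b/` requested by name (ROUTES v6 §10 S-k5), not a `T4Continuum/Support` leaf (FREEZE (0) respected); one
concrete definition (`siteCurv`), no `Prop`-valued fact, no `[cite:]` fact.
-/

set_option autoImplicit false

noncomputable section

namespace Summit.QuantumFields.BalabanUV.T4Continuum.NE7b.EnergyDichotomy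

open Finset
open scoped BigOperators Quaternion NNReal
open Literature.MathematicalPhysics.QuantumFieldTheory (ZdEdge ZdGaugeConfig)
open Literature.Probability.LatticeModels (Site)
open Summit.QuantumFields.BalabanUV.T4Continuum.NE7b.AbelianCurvatureMaximumPrinciple (e layer)
open Summit.QuantumFields.BalabanUV.T4Continuum.NE7b.CovariantDivergenceEL (curv covDiv curv_self)
open Summit.QuantumFields.BalabanUV.T4Continuum.NE7b.CovariantMeanValueInequality (cubeFaces meanValue_inequality)
open Summit.QuantumFields.BalabanUV.T4Continuum.NE7b.EnergyQuantumLemma (srwKernel energy_quantum)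

variable {d : ℕ}

/-! ## §1 The site sine-curvature `max_{(i,j)} ‖E_{ij}(x)‖` -/

/-- The SITE SINE-CURVATURE `s(x) := max_{(i,j)} ‖E_{ij}(x)‖` over all ordered orientation pairs (ROUTES v6 item 2,
scalar form; the diagonal pairs contribute `0`). Implemented as a `Finset.sup` in `ℝ≥0`, coerced to `ℝ`. -/
def siteCurv (U : ZdGaugeConfig d (Metric.sphere (0 : ℍ) 1)) (x : Site d) : ℝ :=
  ((Finset.univ : Finset (Fin d × Fin d)).sup fun p => ‖curv U x p.1 p.2‖₊ : ℝ≥0)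

/-- `s(x) ≥ 0`. -/
theorem siteCurv_nonneg (U : ZdGaugeConfig d (Metric.sphere (0 : ℍ) 1)) (x : Site d) : 0 ≤ siteCurv U x :=
  NNReal.coe_nonneg _

/-- Every orientation is below the maximum: `‖E_{ij}(x)‖ ≤ s(x)`. -/
theorem norm_curv_le_siteCurv (U : ZdGaugeConfig d (Metric.sphere (0 : ℍ) 1)) (x : Site d) (i j : Fin d) :
    ‖curv U x i j‖ ≤ siteCurv U x := by
  have h : (fun p : Fin d × Fin d => ‖curv U x p.1 p.2‖₊) (i, j)
      ≤ (Finset.univ : Finset (Fin d × Fin d)).sup fun p => ‖curv U x p.1 p.2‖₊ :=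
    Finset.le_sup (f := fun p : Fin d × Fin d => ‖curv U x p.1 p.2‖₊) (Finset.mem_univ (i, j))
  have h' : ((‖curv U x i j‖₊ : ℝ≥0) : ℝ) ≤ siteCurv U x := NNReal.coe_le_coe.mpr h
  rwa [coe_nnnorm] at h'

/-- The maximum is below any common nonnegative bound of the orientations. -/
theorem siteCurv_le (U : ZdGaugeConfig d (Metric.sphere (0 : ℍ) 1)) (x : Site d) {t : ℝ} (ht : 0 ≤ t)
    (h : ∀ i j : Fin d, ‖curv U x i j‖ ≤ t) : siteCurv U x ≤ t := by
  have hsup : ((Finset.univ : Finset (Fin d × Fin d)).sup fun p => ‖curv U x p.1 p.2‖₊) ≤ (⟨t, ht⟩ : ℝ≥0) :=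
    Finset.sup_le fun p _ => by
      rw [← NNReal.coe_le_coe, coe_nnnorm]
      exact h p.1 p.2
  exact NNReal.coe_le_coe.mpr hsup

/-- `s(x)² ≤ Σ_{(i,j)} ‖E_{ij}(x)‖²` (the maximum is attained; `d ≥ 1`). -/
theorem siteCurv_sq_le_sum (hd : 0 < d) (U : ZdGaugeConfig d (Metric.sphere (0 : ℍ) 1)) (x : Site d) :
    siteCurv U x ^ 2 ≤ ∑ p : Fin d × Fin d, ‖curv U x p.1 p.2‖ ^ 2 := by
  haveI : Nonempty (Fin d) := ⟨⟨0, hd⟩⟩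
  obtain ⟨p, _, hp⟩ := Finset.exists_mem_eq_sup (Finset.univ : Finset (Fin d × Fin d)) Finset.univ_nonempty
    (fun p => ‖curv U x p.1 p.2‖₊)
  have hs : siteCurv U x = ‖curv U x p.1 p.2‖ := by
    simp only [siteCurv, hp, coe_nnnorm]
  rw [hs]
  exact Finset.single_le_sum (f := fun q : Fin d × Fin d => ‖curv U x q.1 q.2‖ ^ 2) (fun q _ => sq_nonneg _)
    (Finset.mem_univ p)

/-- A global hypothesis on plaquettes transfers to the twelve cube faces entering `meanValue_inequality`. -/
theorem forall_mem_cubeFaces (U : ZdGaugeConfig d (Metric.sphere (0 : ℍ) 1)) {P : Metric.sphere (0 : ℍ) 1 → Prop}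
    (h : ∀ (y : Site d) (a c : Fin d), P (ZdGaugeConfig.plaquette U y a c)) (x x' : Site d) (i j k : Fin d) :
    ∀ q ∈ cubeFaces U x i j k ++ cubeFaces U x' i j k, P q := by
  intro q hq
  simp only [cubeFaces, List.mem_append, List.mem_cons, List.not_mem_nil, or_false] at hq
  rcases hq with (rfl | rfl | rfl | rfl | rfl | rfl) | (rfl | rfl | rfl | rfl | rfl | rfl) <;> exact h _ _ _

/-- **THE ORIENTATION-MAXIMUM OF (β₄) IS A SUBSOLUTION** (`d ≥ 2`). If the four links of every plaquette based at `x`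
are critical, `Re P ≥ 0` everywhere and `‖E‖ ≤ m ≤ ½` everywhere, then `2d·s(x) ≤ Σ_{λ,±} s(x±e_λ) + 232(d−2)·m²`
(`meanValue_inequality` orientation by orientation, `‖E_{ij}(x±e_λ)‖ ≤ s(x±e_λ)`, and the maximum of quantities `≤ R∕2d`
is `≤ R∕2d`; the diagonal orientations are `0`). -/
theorem siteCurv_subsolution (hd2 : 2 ≤ d) (U : ZdGaugeConfig d (Metric.sphere (0 : ℍ) 1)) (x : Site d) {m : ℝ}
    (hm : 0 ≤ m) (hm2 : m ≤ 1 / 2) (hre : ∀ (y : Site d) (a c : Fin d), 0 ≤ ((ZdGaugeConfig.plaquette U y a c : _) : ℍ).re)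
    (henv : ∀ (y : Site d) (a c : Fin d), ‖curv U y a c‖ ≤ m)
    (hcrit : ∀ i j : Fin d, i ≠ j → covDiv U x i = 0 ∧ covDiv U (x + e j) i = 0) :
    2 * (d : ℝ) * siteCurv U x ≤
      (∑ l : Fin d, (siteCurv U (x + e l) + siteCurv U (x - e l))) + 232 * ((d : ℝ) - 2) * m ^ 2 := by
  set R := (∑ l : Fin d, (siteCurv U (x + e l) + siteCurv U (x - e l))) + 232 * ((d : ℝ) - 2) * m ^ 2 with hR
  have hd' : (0 : ℝ) < 2 * (d : ℝ) := by
    have : (0 : ℝ) < d := by exact_mod_cast (show 0 < d by omega)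
    positivity
  have hdm : (0 : ℝ) ≤ (d : ℝ) - 2 := by
    have : (2 : ℝ) ≤ d := by exact_mod_cast hd2
    linarith
  have hR0 : 0 ≤ R :=
    add_nonneg (Finset.sum_nonneg fun l _ => add_nonneg (siteCurv_nonneg U _) (siteCurv_nonneg U _)) (by positivity)
  -- each orientation is bounded by `R`
  have hpair : ∀ i j : Fin d, 2 * (d : ℝ) * ‖curv U x i j‖ ≤ R := by
    intro i j
    by_cases hij : i = j
    · subst hij
      rwa [curv_self, norm_zero, mul_zero]
    · have hre' := forall_mem_cubeFaces U (P := fun q => 0 ≤ ((q : _) : ℍ).re) hre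
      have him' := forall_mem_cubeFaces U (P := fun q => ‖((q : _) : ℍ).im‖ ≤ m) henv
      have hmv := meanValue_inequality U x i j hij hm hm2 (fun k _ _ => hre' x _ i j k) (fun k _ _ => him' x _ i j k)
        (hcrit i j hij).1 (hcrit j i (Ne.symm hij)).1 (hcrit i j hij).2 (hcrit j i (Ne.symm hij)).2
      exact hmv.trans (add_le_add (Finset.sum_le_sum fun k _ =>
        add_le_add (norm_curv_le_siteCurv U _ i j) (norm_curv_le_siteCurv U _ i j)) le_rfl)
  have := siteCurv_le U x (div_nonneg hR0 hd'.le) fun i j => by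
    rw [le_div_iff₀ hd']; linarith [hpair i j]
  rwa [le_div_iff₀ hd', mul_comm] at this

/-! ## §2 The dichotomy (L1) on `ℤ⁴` -/

/-- **(L1) — THE ENERGY DICHOTOMY FOR CRITICAL CONFIGURATIONS ON `ℤ⁴`.** `U` a unit-quaternion configuration, `I` a
finite set of base points (the hole), `b ≥ 0`, `η > 0`, and the heat-kernel hypothesis `hC` of `energy_quantum`. Suppose:
every link of every plaquette based in `I` is critical (`covDiv U x i = 0 = covDiv U (x+e_j) i`, `x ∈ I`, `i ≠ j`); `Re P ≥ 0`
everywhere; `‖E‖ ≤ ½` on `I`; `‖E‖ ≤ b` at every base point outside `I` (on the second branch `b < max_I s ≤ ½`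
automatically). Then EITHER `‖E_{ij}(x)‖ ≤ (1+η)·b` for all
`x ∈ I` and all `i, j` (the sup bound, with NO clause), OR `Σ_{x∈I} s(x)² ≥ η⁴∕((1+η)⁴·C·464²)` (a quantum of energy,
INDEPENDENT of the size of `E` and of `I`). -/
theorem dichotomy (U : ZdGaugeConfig 4 (Metric.sphere (0 : ℍ) 1)) (I : Finset (Site 4)) {C b η : ℝ}
    (hC : ∀ (n : ℕ) (x y : Site 4), 0 < n → (n : ℝ) ^ 2 * srwKernel n x y ≤ C) (hb : 0 ≤ b) (hη : 0 < η)
    (hcrit : ∀ x ∈ I, ∀ i j : Fin 4, i ≠ j → covDiv U x i = 0 ∧ covDiv U (x + e j) i = 0)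
    (hre : ∀ (y : Site 4) (a c : Fin 4), 0 ≤ ((ZdGaugeConfig.plaquette U y a c : _) : ℍ).re)
    (hhalf : ∀ x ∈ I, ∀ i j : Fin 4, ‖curv U x i j‖ ≤ 1 / 2) (hout : ∀ y ∉ I, ∀ i j : Fin 4, ‖curv U y i j‖ ≤ b) :
    (∀ x ∈ I, ∀ i j : Fin 4, ‖curv U x i j‖ ≤ (1 + η) * b)
      ∨ η ^ 4 / ((1 + η) ^ 4 * C * 464 ^ 2) ≤ ∑ x ∈ I, siteCurv U x ^ 2 := by
  rcases I.eq_empty_or_nonempty with hI | hI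
  · exact Or.inl fun x hx => by simp [hI] at hx
  obtain ⟨p₀, hp₀, hmax⟩ := Finset.exists_max_image I (siteCurv U) hI
  by_cases hle : siteCurv U p₀ ≤ (1 + η) * b
  · exact Or.inl fun x hx i j => (norm_curv_le_siteCurv U x i j).trans ((hmax x hx).trans hle)
  right
  have hgap : (1 + η) * b < siteCurv U p₀ := not_le.mp hle
  set M := siteCurv U p₀ with hM
  have hbM : b ≤ M := by nlinarith
  have hM0 : 0 ≤ M := siteCurv_nonneg U p₀
  have hM2 : M ≤ 1 / 2 := siteCurv_le U p₀ (by norm_num) (hhalf p₀ hp₀)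
  -- the envelope: every sine-curvature is `≤ M`
  have henv : ∀ (y : Site 4) (a c : Fin 4), ‖curv U y a c‖ ≤ M := fun y a c => by
    by_cases hy : y ∈ I
    · exact (norm_curv_le_siteCurv U y a c).trans (hmax y hy)
    · exact (hout y hy a c).trans hbM
  -- (i) with source `464·M²`
  have hsub : ∀ x ∈ I, 8 * siteCurv U x ≤ (∑ l : Fin 4, (siteCurv U (x + e l) + siteCurv U (x - e l))) + 464 * M ^ 2 :=
    fun x hx => by
      have h := siteCurv_subsolution (d := 4) (by norm_num) U x hM0 hM2 hre henv (hcrit x hx)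
      norm_num at h
      linarith
  -- (ii) on the layer
  have hbdry : ∀ y ∈ layer I, siteCurv U y ≤ b := fun y hy =>
    siteCurv_le U y hb (hout y (Finset.mem_sdiff.mp hy).2)
  exact energy_quantum hC (by norm_num) hb hη hsub hbdry hp₀ le_rfl hgap

/-- **(L1), energy as a sum over plaquettes.** The same dichotomy with `Σ_{x∈I} Σ_{(i,j)} ‖E_{ij}(x)‖²` (all ordered
orientation pairs; `s(x)² ≤ Σ_{(i,j)} ‖E_{ij}(x)‖²`). -/
theorem dichotomy_sum (U : ZdGaugeConfig 4 (Metric.sphere (0 : ℍ) 1)) (I : Finset (Site 4)) {C b η : ℝ}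
    (hC : ∀ (n : ℕ) (x y : Site 4), 0 < n → (n : ℝ) ^ 2 * srwKernel n x y ≤ C) (hb : 0 ≤ b) (hη : 0 < η)
    (hcrit : ∀ x ∈ I, ∀ i j : Fin 4, i ≠ j → covDiv U x i = 0 ∧ covDiv U (x + e j) i = 0)
    (hre : ∀ (y : Site 4) (a c : Fin 4), 0 ≤ ((ZdGaugeConfig.plaquette U y a c : _) : ℍ).re)
    (hhalf : ∀ x ∈ I, ∀ i j : Fin 4, ‖curv U x i j‖ ≤ 1 / 2) (hout : ∀ y ∉ I, ∀ i j : Fin 4, ‖curv U y i j‖ ≤ b) :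
    (∀ x ∈ I, ∀ i j : Fin 4, ‖curv U x i j‖ ≤ (1 + η) * b)
      ∨ η ^ 4 / ((1 + η) ^ 4 * C * 464 ^ 2) ≤ ∑ x ∈ I, ∑ p : Fin 4 × Fin 4, ‖curv U x p.1 p.2‖ ^ 2 := by
  refine (dichotomy U I hC hb hη hcrit hre hhalf hout).imp_right fun h => h.trans ?_
  exact Finset.sum_le_sum fun x _ => siteCurv_sq_le_sum (by norm_num) U x

end Summit.QuantumFields.BalabanUV.T4Continuum.NE7b.EnergyDichotomy
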